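import Mathlib
import Summits.Ventures.PercRepro2.Defs
import Summits.Ventures.PercRepro2.Harris
import Summits.Ventures.PercRepro2.Exploration
import Summits.Ventures.PercRepro2.GcTransport

/-!
# Closing a set of edges is percolation with those weights set to `0`

For a finite edge set `S`, the law of `ω ↦ restrict Sᶜ ω` (every edge of `S` closed) under the
product weights `p` is the product law with the weights of `S` set to `0`:
`P_p(β(restrict Sᶜ ω)) = P_{p_S}(β)`, `p_S = p` zeroed on `S` (`prob_restrict_compl_eq`).  This
transports every statement about the *outside graph* `G₁` of a root-only pocket — the percolation
with the pocket edges closed — to an ordinary percolation statement for the weights `zeroOn S p`,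
to which the tree's BHK inequalities apply.  Proof: induction on `S` from the single-edge forcing
identity `RECM.prob_update_zero_eq_preimage`.
-/

namespace Summit.Ventures.PercRepro2

namespace PocketConn

variable {E : Type*} [DecidableEq E] {R : Type*} [CommRing R]

/-- The weights with the edges of `S` set to `0`. -/
def zeroOn (S : Finset E) (p : E → R) : E → R := fun e => if e ∈ S then 0 else p e

/-- The configuration with the edges of `S` closed. -/
def closeOn (S : Finset E) (ω : Config E) : Config E := fun e => if e ∈ S then false else ω e

/-- Zeroing no edge changes nothing. -/
@[simp] lemma zeroOn_empty (p : E → R) : zeroOn ∅ p = p := by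
  funext e
  simp [zeroOn]

/-- Closing no edge changes nothing. -/
@[simp] lemma closeOn_empty (ω : Config E) : closeOn ∅ ω = ω := by
  funext e
  simp [closeOn]

/-- Zeroing one more edge is a single update. -/
lemma zeroOn_insert (S : Finset E) (e : E) (p : E → R) :
    zeroOn (insert e S) p = Function.update (zeroOn S p) e 0 := by
  funext e'
  by_cases h : e' = e
  · subst h
    simp [zeroOn]
  · simp [zeroOn, h]

/-- Closing one more edge is a single update. -/
lemma closeOn_insert (S : Finset E) (e : E) (ω : Config E) :
    closeOn (insert e S) ω = Function.update (closeOn S ω) e false := by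
  funext e'
  by_cases h : e' = e
  · subst h
    simp [closeOn]
  · simp [closeOn, h]

/-- Zeroed weights remain a probability vector. -/
lemma IsProbVec.zeroOn {p : E → R} [LinearOrder R] [IsStrictOrderedRing R] (hp : IsProbVec p)
    (S : Finset E) : IsProbVec (zeroOn S p) := by
  refine ⟨fun e => ?_, fun e => ?_⟩ <;> by_cases h : e ∈ S
  · simp [PocketConn.zeroOn, h]
  · simp [PocketConn.zeroOn, h, hp.nonneg e]
  · simp [PocketConn.zeroOn, h]
  · simp [PocketConn.zeroOn, h, hp.le_one e]

section Prob

variable [Fintype E]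

/-- **Closing `S` is zeroing `S`**: `P_{p_S}(A) = P_p(closeOn S ω ∈ A)`. -/
theorem prob_zeroOn (S : Finset E) (p : E → R) (A : Set (Config E)) :
    prob (zeroOn S p) A = prob p {ω | closeOn S ω ∈ A} := by
  induction S using Finset.induction_on generalizing A with
  | empty => simp
  | insert e S he ih =>
    rw [zeroOn_insert, RECM.prob_update_zero_eq_preimage, ih]
    congr 1
    ext ω
    simp only [Set.mem_setOf_eq, Set.mem_preimage, closeOn_insert]

omit [Fintype E] in
/-- `closeOn S` is `restrict Sᶜ`. -/
lemma closeOn_eq_restrict (S : Finset E) (ω : Config E) :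
    closeOn S ω = restrict (↑S : Set E)ᶜ ω := by
  funext e
  by_cases h : e ∈ S
  · simp [closeOn, restrict, h]
  · simp [closeOn, restrict, h]

/-- **Transport**: the law of the configuration with the edges of `F` closed is the product law
with the weights of `F` set to `0`. -/
theorem prob_restrict_compl_eq (F : Set E) [DecidablePred (· ∈ F)] (p : E → R)
    (β : Config E → Prop) :
    prob p {ω | β (restrict Fᶜ ω)} = prob (zeroOn F.toFinset p) {ω | β ω} := by
  rw [prob_zeroOn]
  congr 1
  ext ω
  simp only [Set.mem_setOf_eq, closeOn_eq_restrict]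
  have : restrict (↑F.toFinset : Set E)ᶜ ω = restrict Fᶜ ω := by
    funext e
    by_cases h : e ∈ F
    · have h1 : e ∉ Fᶜ := fun h' => h' h
      have h2 : e ∉ (↑F.toFinset : Set E)ᶜ := fun h' => h' (by simpa using h)
      rw [restrict_apply_of_notMem h1, restrict_apply_of_notMem h2]
    · have h1 : e ∈ Fᶜ := h
      have h2 : e ∈ (↑F.toFinset : Set E)ᶜ := fun h' => h (by simpa using h')
      rw [restrict_apply_of_mem h1, restrict_apply_of_mem h2]
  rw [this]

end Prob

end PocketConn

end Summit.Ventures.PercRepro2
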